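import Literature.MathematicalPhysics.QuantumFieldTheory.Balaban1983to89.Node00.TorusCoverLandau153RecDatumDoor

/-!
# NODE 00 — THE R7 DOOR AT THE PRINT DATUM, FED FROM THE RUN's (1.7)∕(1.9) BOUNDS: FILE-10's `exists_datumGauge152_153_member_of_recBody` with the `SU(N)` crown body OBTAINED from a
# PER-DATUM CROWN IMPLICATION «`A_k({□̃ᶻ}, α) ⇒ body at radius C·α`» (R6's conclusion specialised to the record datum — the HYPOTHESIS `hP6`) and the class `A_k` SUPPLIED by the run's bounds
# through the top-anchored lift (STAGE 3a's `inAk_coverLiftShift_tcubeZ_of_top`, tolerances by dag-n07-e's `tol_of_level_pred`) — the record twin of dag-n07-e's ∕ this lineage's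
# `exists_localGauge152_153_cube_of_prop6P` up to the packaging of R6

Cell `pub-ymgap`, width seat `pub-ymgap-dag-n07-w3` g10 (N05-REC R7 pen; LEAD PEN dag-n05-e).  NEW leaf: §0 five transport∕reading lemmas (level cubes through the translated cover) + ONE door theorem, composition by name: `inAk_coverLiftShift_tcubeZ_of_top` (FILE-8) with
`lvl := fun _ => k − 1`, `α := L³·ε_{k−1}` (`tol_of_level_pred`), then `hP6` (stated at that `α` only), then FILE-10.  `--kind proof --supports stmt-QuantumFields-20541` (K0⁷; count-neutral).
[15] = [Balaban1985Variational]; [6] = [Balaban1985RegularSpaces]; [B6] = [Balaban1984PropagatorsII]; [I] = [Balaban1987RG1].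

WHAT IS PROVED (kernel; `P : Params`, `N ≥ 1`, `d ≥ 2`; no definition).  ★★★ `exists_datumGauge152_153_member_of_crownAt`: for `1 ≤ k ≤ m + K`, `k ≤ kT + 1`, `0 < ε_{k−1}`, `L ≤ ρ`, a grid index
`idx`, a torus field `U` in the run's class «`PlaqSmallOn (omegaPlaqsTop Ω Ω₀ m) (ε_m η_m²)`, `CoDivSmallOn (omegaBondsTop Ω Ω₀ m) (ε_m η_m³)`, `m ≤ kT`», the collar inclusion
«`π '' tcube L (cornerP P Mc ρ idx) (sideP P Mc ρ) ρ k ⊆ Ω_{k−1}`-region» (dag-n07-e's `cover_image_Ω_cubeIdxP'_subset`), the non-wrapping of that `□̃`, a constant `0 ≤ Cr` with the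
per-datum crown implication AT THE ONE TOLERANCE THE PROOF READS, `α_k := L³·ε_{k−1}`: `hP6 : InAk L k η_k α_k (fun _ => □̃ᶻ) V → <SU ∃-body of GaugedBoundB8DZ L η_k V (propCubePZ …) (Cr·α_k)>` (R6's crown is THRESHOLDED — «`7dL²·M·α₀ ≤ c₁ →` body» — so `hP6` is stated at `α_k` only; the knit discharges the threshold from `ε_{k−1} ≤ a₀`) and the window `4·(N·(Cr·L³ε_{k−1})) < 2π`:
the conclusion of FILE-10 at `r := Cr·L³·ε_{k−1}` — EIGHT of `HThm4Rec`'s nine rows in its own torus currency (row 2, the level letters, now also read on `regionOfSet (π '' cube … k j).bonds` via §0 ★★ `norm_le_of_mem_regionOfSet_cover_image_cube`: each such torus bond is the image of one bond of `□_jᶻ`, by the non-wrapping of `□̃`) + the member rows of the ninth.  §0: `propCubePZ_sq_eq_cubeZ`, ★ `mem_of_shift_mem_cover_image_of_injOn`, ★ `add_e_mem_cubeZ_of_coverShift_mem_image`, ★★ `norm_le_of_mem_regionOfSet_cover_image_cube`, ★ `injOn_cover_tcube_of_guard` (the door's `hinj` from `HThm4Rec`'s no-wrap guard `Mc + 11d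 + 6ρ ≤ sitesPerDir k`).
HONEST FRAMING: count-neutral composition by name; `hP6` is R6's conclusion at the datum, a HYPOTHESIS; nothing of [15] ∕ [6] ∕ [B6] ∕ [I] analysis asserted; `HThm4Rec` UNDISCHARGED
(caveat (C-S3-1)) — NOT the knit (the `Nrm` row, `κ := b9OfP …`, `a₀ := a0OfP …`, the `Within 3` ⇒ collar-inclusion step of the S6 head, and R6 itself remain); N07 ∕ N05 NOT discharged; counts
unmoved; one finite 𝕋⁴ programme at fixed ε — R4 closes the conditional finite-𝕋⁴ rung `BalabanLadder.UV` only; the YM mass gap (Clay) is NOT proved by any of this; nothing continuum ∕ ℝ⁴ ∕ OS.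
No `sorry`, no `def`, no `instance`, no `notation`.

References: [15] (144)–(153) pp.300–301; [6] Prop. 6 (1.135)–(1.138) p.99, (1.7)–(1.9) p.77, (1.29) p.81, (1.131) p.99, p.98; [B6] (2.10)–(2.12) p.225; [Balaban1988Convergent] (1.4) p.247;
[I] (0.1) p.251, (0.3)–(0.4) pp.252–253.
-/

noncomputable section

namespace Literature.MathematicalPhysics.QuantumFieldTheory.Balaban1983to89.Node00

open scoped Matrix.Norms.L2Operator
open B7Prop1Explicit (e e_apply gaugeAct)
open B7Prop1Local (InBox AgreeOn)
open B7Prop2Explicit (unitaryUnits mem_unitaryUnits)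
open B7Prop2SpecialUnitary (specialUnitaryUnits mem_specialUnitaryUnits)
open BlockAveragingZd (avgIterZ ctrShift)
open B8Ineq132 (covDerivFwd covDeriv BondTouches InAk)
open B8Eq131Cubes (box cube tcube tLo tHi ctr gs)
open B8Eq131CubesRec (boxZ cubeZ tcubeZ bLoZ bHiZ)
open B8Eq131CubesRecDictionary (mem_cubeZ_iff_add_ctrShift)
open B8Eq140Level (SideTouches)
open B8Eq138LandauZd (logCfg covDivB covLap)
open B8Eq138LandauZdRec (IsLandau138Z IsLandau138WZ)
open B8Eq119TwistedAxialRec (Restr129Z)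
open B7SectEFLinearisationRec (logCovIterZ)
open B8Eq184Proof (cfgExp)
open B8LeafModelZd3 (mlogCfg)
open B8ScaledSupNorm (msup Bdd bondNorm)
open B8Eq146AExpansion (plaqCovDeriv iEta)
open B8Eq143PlaqExpansion (pdiv)
open MatrixLog (mlog)
open B15Eq112TorusCover (cover)
open B14DomainGeom (Pt)
open B12RegularSpaces111 (gaugeU expI grad)
open B6SectADomainsV1 (Domains)
open B6SectAOperatorsV1 (RE dsE QpE)
open BalabanImbrieJaffe1984to88.BIJ85AxialPropagator411 (BondSpace)

variable {P : Params} {N : ℕ} [NeZero N]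

/-! ## §0  Level cubes through `x ↦ π(x + ctrShift L k·𝟙)`: `HThm4Rec`'s row-2 currency -/

omit [NeZero N] in
/-- Every level of the print datum's tower is the pure centred cube: `(propCubePZ …).sq j = □_jᶻ` for `j ≤ k` (the dent is empty for the constant family `fun _ => □̃ᶻ`).
[cite: Balaban1985Variational, (150) p.301; Balaban1985RegularSpaces, p.98] -/
theorem propCubePZ_sq_eq_cubeZ (n : ℕ) (hn : 1 ≤ n) (M ρ : ℕ) (hρ : P.L ≤ ρ) (a : Pt P.d) {j : ℕ} (hj : j ≤ n) :
    (propCubePZ P n hn M ρ hρ a).sq j = cubeZ P.L (cornerP P M ρ a) (sideP P M ρ) ρ n j := by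
  rcases hj.lt_or_eq with h | rfl
  · exact (propCubePZ P n hn M ρ hρ a).sq_of_lt h
  · exact propCubePZ_sq_top (P := P) _ hn M ρ hρ a

omit [NeZero N] in
/-- ★ **A FORWARD UNIT STEP SEEN ON THE TORUS PULLS BACK** into any `S ⊆ T` on which `π` is injective, provided the stepped point stays in `T`: `π x + e_μ ∈ π(S)`, `x + e_μ ∈ T`
⇒ `x + e_μ ∈ S`. [cite: Balaban1987RG1, (0.1) p.251 (the torus cover); Balaban1985RegularSpaces, p.98] -/
theorem mem_of_shift_mem_cover_image_of_injOn {T S : Set (Pt P.d)} (hinj : Set.InjOn (cover P) T) (hST : S ⊆ T) {x : Pt P.d} {μ : Fin P.d}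
    (hxT : x + e μ ∈ T) (h : (cover P x).shift μ ∈ cover P '' S) : x + e μ ∈ S := by
  obtain ⟨x', hx', hc⟩ := h
  rw [← cover_add_e] at hc
  rw [← hinj (hST hx') hxT hc]
  exact hx'

omit [NeZero N] in
/-- ★ **FORWARD UNIT STEPS SEEN ON THE TRANSLATED COVER PULL BACK INTO EVERY LEVEL CUBE `□_jᶻ`** (`j ≤ k`; collar `□_j + 1 ⊆ □̃` of [6] p. 98 and the non-wrapping of `□̃`):
STAGE 3's `CubeB8DZ.add_e_mem_sq_zero_of_shift_mem_image` at every level. [cite: Balaban1985RegularSpaces, p.98, (1.131) p.99; Balaban1987RG1, (0.1) p.251, (0.3) p.252] -/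
theorem add_e_mem_cubeZ_of_coverShift_mem_image {a : Pt P.d} {M ρ k j : ℕ} (hρ : 1 ≤ ρ) (hj : j ≤ k) (hinj : Set.InjOn (cover P) (tcube P.L a M ρ k))
    {x : Pt P.d} (hx : x ∈ cubeZ P.L a M ρ k j) {μ : Fin P.d}
    (h : (cover P (x + fun _ => (ctrShift P.L k : ℤ))).shift μ ∈ (fun x => cover P (x + fun _ => (ctrShift P.L k : ℤ))) '' cubeZ P.L a M ρ k j) :
    x + e μ ∈ cubeZ P.L a M ρ k j := by
  have hL : 2 ≤ P.L := P.hL.2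
  rw [image_coverShift_cubeZ a M ρ hj] at h
  have hx' : (x + fun _ => (ctrShift P.L k : ℤ)) ∈ cube P.L a M ρ k j := (mem_cubeZ_iff_add_ctrShift P.hL.1 a M ρ hj x).1 hx
  have hT : (x + fun _ => (ctrShift P.L k : ℤ)) + e μ ∈ tcube P.L a M ρ k :=
    B8Eq131Cubes.collar_cube hL hρ hj _ hx' _ fun i => by
      simp only [Pi.add_apply, e_apply]; split_ifs <;> constructor <;> linarith
  have hmem := mem_of_shift_mem_cover_image_of_injOn hinj (B8Eq131Cubes.cube_subset_tcube hL hρ hj) hT h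
  rw [add_right_comm] at hmem
  exact (mem_cubeZ_iff_add_ctrShift P.hL.1 a M ρ hj (x + e μ)).2 hmem

omit [NeZero N] in
/-- ★★ **LEVEL LETTERS IN THE TORUS CURRENCY OF `HThm4Rec`'s ROW 2**: a per-level bound for `A(π(x + c_k·𝟙), μ)` over the bonds `x, x + e_μ ∈ □_jᶻ` IS the bound «for all
`b ∈ regionOfSet (π '' cube L a M ρ k j).bonds`» — each such torus bond is the image of exactly one bond of `□_jᶻ` (non-wrapping of `□̃`).
[cite: Balaban1985Variational, (152) p.301; Balaban1985RegularSpaces, (1.137) p.99, p.98; Balaban1987RG1, (0.1) p.251, (1.13) p.262] -/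
theorem norm_le_of_mem_regionOfSet_cover_image_cube {a : Pt P.d} {M ρ k : ℕ} (hρ : 1 ≤ ρ) (hinj : Set.InjOn (cover P) (tcube P.L a M ρ k))
    {A : PBond P 0 → MatA N} {R : ℕ → ℝ}
    (hlev : ∀ j, j ≤ k → ∀ (x : Pt P.d) (μ : Fin P.d), x ∈ cubeZ P.L a M ρ k j → x + e μ ∈ cubeZ P.L a M ρ k j →
      ‖A ⟨cover P (x + fun _ => (ctrShift P.L k : ℤ)), μ⟩‖ ≤ R j)
    {j : ℕ} (hj : j ≤ k) : ∀ b ∈ (Sect2.regionOfSet P (cover P '' cube P.L a M ρ k j)).bonds, ‖A b‖ ≤ R j := by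
  intro b hb
  rw [Sect2.mem_regionOfSet_bonds, ← image_coverShift_cubeZ a M ρ hj] at hb
  obtain ⟨⟨x, hx, hxb⟩, htgt⟩ := hb
  have hxb' : cover P (x + fun _ => (ctrShift P.L k : ℤ)) = b.src := hxb
  have h' : (cover P (x + fun _ => (ctrShift P.L k : ℤ))).shift b.dir ∈ (fun x => cover P (x + fun _ => (ctrShift P.L k : ℤ))) '' cubeZ P.L a M ρ k j := by
    rw [hxb']; exact htgt
  have hA := hlev j hj x b.dir hx (add_e_mem_cubeZ_of_coverShift_mem_image hρ hj hinj hx h')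
  rw [hxb'] at hA
  exact hA

omit [NeZero N] in
/-- ★ **THE PRINT DATUM's `□̃` DOES NOT WRAP UNDER `HThm4Rec`'s NO-WRAP GUARD** `Mc + 11d + 6ρ ≤ sitesPerDir k` (`k` in the standing range): `sideP ≤ Mc + 11d + 2ρ`
(`sideP_le`) and `sitesPerDir 0 = Lᵏ·sitesPerDir k` feed STAGE 3's `injOn_cover_tcube_of_width`. [cite: Balaban1985RegularSpaces, p.98 («□̃»); Balaban1987RG1, (0.1) p.251] -/
theorem injOn_cover_tcube_of_guard {a : Pt P.d} {Mc ρ k : ℕ} (hk : k ≤ P.m + P.K) (hg : Mc + 11 * P.d + 6 * ρ ≤ P.sitesPerDir k) :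
    Set.InjOn (cover P) (tcube P.L (cornerP P Mc ρ a) (sideP P Mc ρ) ρ k) := by
  refine injOn_cover_tcube_of_width (P := P) ?_
  have hs := sideP_le (P := P) Mc ρ
  calc (sideP P Mc ρ + 4 * ρ) * P.L ^ k ≤ (Mc + 11 * P.d + 6 * ρ) * P.L ^ k := Nat.mul_le_mul_right _ (by omega)
    _ ≤ P.sitesPerDir k * P.L ^ k := Nat.mul_le_mul_right _ hg
    _ = P.sitesPerDir 0 := by
      rw [Params.sitesPerDir, Params.sitesPerDir, Nat.sub_zero, mul_assoc, ← pow_add, Nat.sub_add_cancel hk]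

/-! ## §1  The door at the print datum, fed from the run's bounds -/

/-- ★★★ **THE R7 DOOR AT THE PRINT DATUM, FED FROM THE RUN's BOUNDS** (statement in the module docstring).
[cite: Balaban1985Variational, (144)–(153) pp.300–301; Balaban1985RegularSpaces, Prop. 6 (1.135)–(1.138) p.99, (1.7)–(1.9) p.77, (1.29) p.81; Balaban1984PropagatorsII, (2.10)–(2.12) p.225; Balaban1988Convergent, (1.4) p.247; Balaban1987RG1, (0.1) p.251, (0.3)–(0.4) pp.252–253] -/
theorem exists_datumGauge152_153_member_of_crownAt (hd : 2 ≤ P.d) {k : ℕ} (hk₁ : 1 ≤ k) (hck : k ≤ P.m + P.K) {Mc ρ : ℕ} (hρ : P.L ≤ ρ) (idx : Pt P.d)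
    {Ω : ℕ → Set (Site P 0)} {Ω₀ : Set (Site P 0)} {kT : ℕ} {ε : ℕ → ℝ} (U : GaugeField P 0 (SU N))
    (hP : ∀ m, m ≤ kT → PlaqSmallOn (Sect2.omegaPlaqsTop Ω Ω₀ m) (ε m * P.eta m ^ 2) U)
    (hD : ∀ m, m ≤ kT → Sect2.CoDivSmallOn (Sect2.omegaBondsTop Ω Ω₀ m) (ε m * P.eta m ^ 3) U)
    (hkT : k ≤ kT + 1) (hε : 0 < ε (k - 1))
    (hcollar : cover P '' tcube P.L (cornerP P Mc ρ idx) (sideP P Mc ρ) ρ k ⊆ (if k - 1 = 0 then Ω₀ else Ω (k - 1)))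
    {Cr : ℝ} (hCr : 0 ≤ Cr)
    (hP6 : letI : CStarAlgebra (MatA N) := {};
      InAk P.L k (P.eta k) ((P.L : ℝ) ^ 3 * ε (k - 1)) (fun _ => tcubeZ P.L (cornerP P Mc ρ idx) (sideP P Mc ρ) ρ k)
          (fun x μ => ιSU N (U ⟨cover P (x + fun _ => (ctrShift P.L k : ℤ)), μ⟩)) →
      ∃ u : B7Prop1Explicit.Site P.d → (MatA N)ˣ, (∀ x, u x ∈ specialUnitaryUnits (Fin N)) ∧ (∀ x, x ∉ (propCubePZ P k hk₁ Mc ρ hρ idx).sq 0 → u x = 1) ∧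
        Restr129Z P.L k (propCubePZ P k hk₁ Mc ρ hρ idx).lamS (1 : B7Prop1Explicit.Site P.d → Fin P.d → (MatA N)ˣ) u ∧
        IsLandau138WZ P.L k (P.eta k) ((propCubePZ P k hk₁ Mc ρ hρ idx).sq 0) (propCubePZ P k hk₁ Mc ρ hρ idx).lamS (1 : B7Prop1Explicit.Site P.d → Fin P.d → (MatA N)ˣ)
          ((propCubePZ P k hk₁ Mc ρ hρ idx).fixed (fun x μ => ιSU N (U ⟨cover P (x + fun _ => (ctrShift P.L k : ℤ)), μ⟩)) u) ∧
        (∀ j, j ≤ k → ∀ b ∈ {b : B7Prop1Explicit.Site P.d × Fin P.d | SideTouches ((propCubePZ P k hk₁ Mc ρ hρ idx).sq j) b.1 b.2},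
          (propCubePZ P k hk₁ Mc ρ hρ idx).fixed (fun x μ => ιSU N (U ⟨cover P (x + fun _ => (ctrShift P.L k : ℤ)), μ⟩)) u b.1 b.2 =
              cfgExp (P.eta k) (logCfg (P.eta k) ((propCubePZ P k hk₁ Mc ρ hρ idx).fixed (fun x μ => ιSU N (U ⟨cover P (x + fun _ => (ctrShift P.L k : ℤ)), μ⟩)) u)) b.1 b.2 ∧
            IsSelfAdjoint (logCfg (P.eta k) ((propCubePZ P k hk₁ Mc ρ hρ idx).fixed (fun x μ => ιSU N (U ⟨cover P (x + fun _ => (ctrShift P.L k : ℤ)), μ⟩)) u) b.1 b.2) ∧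
            ‖logCfg (P.eta k) ((propCubePZ P k hk₁ Mc ρ hρ idx).fixed (fun x μ => ιSU N (U ⟨cover P (x + fun _ => (ctrShift P.L k : ℤ)), μ⟩)) u) b.1 b.2‖ ≤
              (Cr * ((P.L : ℝ) ^ 3 * ε (k - 1))) * ((P.L : ℝ) ^ j * P.eta k)⁻¹) ∧
        (∀ x, (((propCubePZ P k hk₁ Mc ρ hρ idx).vfix (fun x μ => ιSU N (U ⟨cover P (x + fun _ => (ctrShift P.L k : ℤ)), μ⟩)))⁻¹ * u) x ∈ specialUnitaryUnits (Fin N)) ∧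
        AgreeOn (B8Ineq130Rec.tlo P.L (tLo (cornerP P Mc ρ idx) ρ) k) (B8Ineq130Rec.thi P.L (tHi (cornerP P Mc ρ idx) (sideP P Mc ρ) ρ) k)
          (gaugeAct (((propCubePZ P k hk₁ Mc ρ hρ idx).vfix (fun x μ => ιSU N (U ⟨cover P (x + fun _ => (ctrShift P.L k : ℤ)), μ⟩)))⁻¹ * u)⁻¹
            (fun x μ => ιSU N (U ⟨cover P (x + fun _ => (ctrShift P.L k : ℤ)), μ⟩)))
          ((propCubePZ P k hk₁ Mc ρ hρ idx).fixed (fun x μ => ιSU N (U ⟨cover P (x + fun _ => (ctrShift P.L k : ℤ)), μ⟩)) u) ∧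
        msup P.L k (P.eta k) (-(2 : ℝ)) (fun j (q : Fin P.d × Fin P.d × B7Prop1Explicit.Site P.d) => SideTouches ((propCubePZ P k hk₁ Mc ρ hρ idx).sq j) q.2.2 q.2.1)
            (fun q => covDerivFwd (P.eta k) (1 : B7Prop1Explicit.Site P.d → Fin P.d → (MatA N)ˣ) q.1
              (fun z => (propCubePZ P k hk₁ Mc ρ hρ idx).expo (P.eta k) (fun x μ => ιSU N (U ⟨cover P (x + fun _ => (ctrShift P.L k : ℤ)), μ⟩)) u z q.2.1) q.2.2) ≤ Cr * ((P.L : ℝ) ^ 3 * ε (k - 1)) ∧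
        bondNorm P.L k (P.eta k) (-(3 : ℝ)) (propCubePZ P k hk₁ Mc ρ hρ idx).sq
            (fun x μ => pdiv (P.eta k) (1 : B7Prop1Explicit.Site P.d → Fin P.d → (MatA N)ˣ)
              (plaqCovDeriv (P.eta k) (1 : B7Prop1Explicit.Site P.d → Fin P.d → (MatA N)ˣ)
                ((propCubePZ P k hk₁ Mc ρ hρ idx).expo (P.eta k) (fun x μ => ιSU N (U ⟨cover P (x + fun _ => (ctrShift P.L k : ℤ)), μ⟩)) u)) μ x) ≤ Cr * ((P.L : ℝ) ^ 3 * ε (k - 1)) ∧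
        bondNorm P.L k (P.eta k) (-(3 : ℝ)) (propCubePZ P k hk₁ Mc ρ hρ idx).sq
            (fun x μ => covLap (P.eta k) (1 : B7Prop1Explicit.Site P.d → Fin P.d → (MatA N)ˣ)
              (fun z => (propCubePZ P k hk₁ Mc ρ hρ idx).expo (P.eta k) (fun x μ => ιSU N (U ⟨cover P (x + fun _ => (ctrShift P.L k : ℤ)), μ⟩)) u z μ) x) ≤ Cr * ((P.L : ℝ) ^ 3 * ε (k - 1)) ∧
        (∀ (x : B7Prop1Explicit.Site P.d) (μ : Fin P.d), bLoZ P.L (cornerP P Mc ρ idx) 0 0 ≤ x → x + e μ ≤ bHiZ P.L (cornerP P Mc ρ idx) (sideP P Mc ρ) 0 0 →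
          (propCubePZ P k hk₁ Mc ρ hρ idx).inTop x → (propCubePZ P k hk₁ Mc ρ hρ idx).inTop (x + e μ) →
          logCovIterZ P.L (1 : B7Prop1Explicit.Site P.d → Fin P.d → (MatA N)ˣ)
              (iEta (P.eta k) ((propCubePZ P k hk₁ Mc ρ hρ idx).expo (P.eta k) (fun x μ => ιSU N (U ⟨cover P (x + fun _ => (ctrShift P.L k : ℤ)), μ⟩)) u)) k x μ =
            mlog ((avgIterZ P.L ((propCubePZ P k hk₁ Mc ρ hρ idx).axial (fun x μ => ιSU N (U ⟨cover P (x + fun _ => (ctrShift P.L k : ℤ)), μ⟩))) k x μ : (MatA N)ˣ) :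
              MatA N)))
    (hinj : Set.InjOn (cover P) (tcube P.L (cornerP P Mc ρ idx) (sideP P Mc ρ) ρ k))
    (h4 : 4 * ((N : ℝ) * (Cr * ((P.L : ℝ) ^ 3 * ε (k - 1)))) < 2 * Real.pi) :
    letI : CStarAlgebra (MatA N) := {}
    ∃ u : GaugeTransf P 0 (SU N), ∃ A : PBond P 0 → MatA N, ∃ um : B7Prop1Explicit.Site P.d → (MatA N)ˣ,
      (∀ b ∈ (Sect2.regionOfSet P (cover P '' cube P.L (cornerP P Mc ρ idx) (sideP P Mc ρ) ρ k 0)).bonds,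
          gaugeU (fun x => ιSU N (u x)) (fun b' => ιSU N (U b')) b = expI (P.eta k) (A b)) ∧
      (∀ j, j ≤ k → ∀ b ∈ (Sect2.regionOfSet P (cover P '' cube P.L (cornerP P Mc ρ idx) (sideP P Mc ρ) ρ k j)).bonds,
          ‖A b‖ ≤ 2 * ((Cr * ((P.L : ℝ) ^ 3 * ε (k - 1))) * ((P.L : ℝ) ^ j * P.eta k)⁻¹)) ∧
      (∀ b ∈ (Sect2.regionOfSet P (cover P '' box P.L (cornerP P Mc ρ idx) (sideP P Mc ρ) k)).bonds, ‖A b‖ ≤ 2 * ((Cr * ((P.L : ℝ) ^ 3 * ε (k - 1))) * P.L)) ∧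
      (∀ q ∈ (Sect2.regionOfSet P (cover P '' box P.L (cornerP P Mc ρ idx) (sideP P Mc ρ) k)).dpairs,
          ‖grad (P.eta k) q.2.1 (fun y => A ⟨y, q.2.2⟩) q.1‖ ≤ 2 * ((Cr * ((P.L : ℝ) ^ 3 * ε (k - 1))) * (P.L : ℝ) ^ 2)) ∧
      (∀ b ∈ Sect2.bondsDeep (cover P '' box P.L (cornerP P Mc ρ idx) (sideP P Mc ρ) k), ‖Sect2.codiffCurlA (P.eta k) A b.src b.dir‖ ≤ 2 * ((Cr * ((P.L : ℝ) ^ 3 * ε (k - 1))) * (P.L : ℝ) ^ 3)) ∧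
      (∀ b ∈ Sect2.bondsDeep (cover P '' box P.L (cornerP P Mc ρ idx) (sideP P Mc ρ) k),
          ‖∑ ν : Fin P.d, ((P.eta k : ℝ) : ℂ)⁻¹ •
              (grad (P.eta k) ν (fun y => A ⟨y, b.dir⟩) (b.src.unshift ν) - grad (P.eta k) ν (fun y => A ⟨y, b.dir⟩) b.src)‖ ≤ 2 * ((Cr * ((P.L : ℝ) ^ 3 * ε (k - 1))) * (P.L : ℝ) ^ 3)) ∧
      (∀ (D₂ : Domains P) (φ : MatA N →L[ℂ] ℂ),
        RE (domainsMeet (cubeDomains P (cornerP P Mc ρ idx) (sideP P Mc ρ) ρ k hck) D₂) (P.eta k)⁻¹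
            (dsE (P.eta k)⁻¹ (WithLp.toLp 2 fun b => (φ (A b)).re : BondSpace P)) = 0 ∧
          RE (domainsMeet (cubeDomains P (cornerP P Mc ρ idx) (sideP P Mc ρ) ρ k hck) D₂) (P.eta k)⁻¹
            (dsE (P.eta k)⁻¹ (WithLp.toLp 2 fun b => (φ (A b)).im : BondSpace P)) = 0) ∧
      (∀ x, x ∈ tcubeZ P.L (cornerP P Mc ρ idx) (sideP P Mc ρ) ρ k → ∀ μ,
          A ⟨cover P (x + fun _ => (ctrShift P.L k : ℤ)), μ⟩ =
            logCfg (P.eta k) ((propCubePZ P k hk₁ Mc ρ hρ idx).fixed (fun x μ => ιSU N (U ⟨cover P (x + fun _ => (ctrShift P.L k : ℤ)), μ⟩)) um) x μ) ∧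
      (∀ x, x ∈ (propCubePZ P k hk₁ Mc ρ hρ idx).sq 0 →
          ιSU N (u (cover P (x + fun _ => (ctrShift P.L k : ℤ)))) =
            (um x)⁻¹ * (propCubePZ P k hk₁ Mc ρ hρ idx).vfix (fun x μ => ιSU N (U ⟨cover P (x + fun _ => (ctrShift P.L k : ℤ)), μ⟩)) x) ∧
      (∀ x, um x ∈ specialUnitaryUnits (Fin N)) ∧ (∀ x, x ∉ (propCubePZ P k hk₁ Mc ρ hρ idx).sq 0 → um x = 1) ∧
      Restr129Z P.L k (propCubePZ P k hk₁ Mc ρ hρ idx).lamS (1 : B7Prop1Explicit.Site P.d → Fin P.d → (MatA N)ˣ) um ∧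
      (∀ (x : B7Prop1Explicit.Site P.d) (μ : Fin P.d), bLoZ P.L (cornerP P Mc ρ idx) 0 0 ≤ x → x + e μ ≤ bHiZ P.L (cornerP P Mc ρ idx) (sideP P Mc ρ) 0 0 →
        (propCubePZ P k hk₁ Mc ρ hρ idx).inTop x → (propCubePZ P k hk₁ Mc ρ hρ idx).inTop (x + e μ) →
        logCovIterZ P.L (1 : B7Prop1Explicit.Site P.d → Fin P.d → (MatA N)ˣ)
            (iEta (P.eta k) ((propCubePZ P k hk₁ Mc ρ hρ idx).expo (P.eta k) (fun x μ => ιSU N (U ⟨cover P (x + fun _ => (ctrShift P.L k : ℤ)), μ⟩)) um)) k x μ =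
          mlog ((avgIterZ P.L ((propCubePZ P k hk₁ Mc ρ hρ idx).axial (fun x μ => ιSU N (U ⟨cover P (x + fun _ => (ctrShift P.L k : ℤ)), μ⟩))) k x μ : (MatA N)ˣ) :
            MatA N)) := by
  letI : CStarAlgebra (MatA N) := {}
  have hηpos : 0 < P.eta k := B3GkZeroTorusRescaled.eta_pos P k
  set α : ℝ := (P.L : ℝ) ^ 3 * ε (k - 1) with hα
  have hαpos : 0 < α := mul_pos (pow_pos (by exact_mod_cast P.L_pos) 3) hε
  have hInAk : InAk P.L k (P.eta k) α (fun _ => tcubeZ P.L (cornerP P Mc ρ idx) (sideP P Mc ρ) ρ k)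
      (fun x μ => ιSU N (U ⟨cover P (x + fun _ => (ctrShift P.L k : ℤ)), μ⟩)) :=
    inAk_coverLiftShift_tcubeZ_of_top N U hP hD (cornerP P Mc ρ idx) (sideP P Mc ρ) ρ k hηpos (fun _ => k - 1) (fun j _ => by omega) (fun j _ => hcollar)
      (fun j hj => (tol_of_level_pred P hk₁ hε.le hj).1) (fun j hj => (tol_of_level_pred P hk₁ hε.le hj).2)
  have hG := hP6 hInAk
  have hr : 0 ≤ Cr * α := mul_nonneg hCr hαpos.le
  have hρ1 : 1 ≤ ρ := le_trans (le_trans (by norm_num) P.hL.2) hρ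
  obtain ⟨u, A, um, h1, hlev, hrest⟩ := exists_datumGauge152_153_member_of_recBody hd hk₁ hck hρ idx U hr hG hinj h4
  refine ⟨u, A, um, h1, fun j hj => ?_, hrest⟩
  -- row 2 in the torus currency: pull each bond of `regionOfSet (π '' □_j)` back to a bond of `□_jᶻ = (propCubePZ …).sq j`
  refine norm_le_of_mem_regionOfSet_cover_image_cube (N := N) hρ1 hinj (R := fun j => 2 * ((Cr * α) * ((P.L : ℝ) ^ j * P.eta k)⁻¹))
    (fun j' hj' x μ hx hx' => ?_) hj
  rw [← propCubePZ_sq_eq_cubeZ (P := P) k hk₁ Mc ρ hρ idx hj'] at hx hx'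
  exact hlev j' hj' x μ hx hx'

end Literature.MathematicalPhysics.QuantumFieldTheory.Balaban1983to89.Node00

end

/-! ## Axiom audit (gate whitelist: `propext`, `Classical.choice`, `Quot.sound`) -/
#print axioms Literature.MathematicalPhysics.QuantumFieldTheory.Balaban1983to89.Node00.exists_datumGauge152_153_member_of_crownAt
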